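import Summits.BirchSwinnertonDyer.BirchSwinnertonDyer.Theorems.ErratumRoadFiveIMCDivRoadFFFittingCutBFeed
import Summits.BirchSwinnertonDyer.BirchSwinnertonDyer.Theorems.ErratumRoadFiveIMCDivRoadFFSigmaDataBNoDefect
import Summits.BirchSwinnertonDyer.BirchSwinnertonDyer.Theorems.ErratumRoadFiveIMCDivMemberCongruenceErratumTame
import Summits.BirchSwinnertonDyer.BirchSwinnertonDyer.Theorems.ErratumRoadFiveOpenInputIMCFromErratumFact
import Summits.BirchSwinnertonDyer.Rank1Residual.X11b.AnticyclotomicLocalTorsionDescent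
import Summits.BirchSwinnertonDyer.Rank1Residual.X11b.EmbeddingDatumPrime
import Literature.NumberTheory.EllipticCurves.Castella2018.ErratumHidaMembersCongruenceTorsionFree
import Literature.NumberTheory.EllipticCurves.Castella2018.SigmaSelmerUnramifiedOutsideSProofs
import Literature.NumberTheory.EllipticCurves.SkinnerUrban2014.CofinitelyGeneratedSelmer
import Literature.NumberTheory.EllipticCurves.CofreeTorsionFiniteness
import Literature.NumberTheory.EllipticCurves.OrdinaryNewformDatumCofreeUnramified
import HarnessLib

/-!
# K2 crux `IMCDivAtErratumDataAllR` (item stmt-BirchSwinnertonDyer-20169; H3♭ re-oriented), ROAD FF v4-B″ —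
# the DECIDING stub from the TORSION-FREE, PREMISE-form member package (design rider R-f = ARM-P R-37)

Cell `bsd-stepL` (run/shared/lean/pub/bsd-stepL/), seat `bsd-stepL-imc-p1` (prover g11, 2026-08-27);
`--supports stmt-BirchSwinnertonDyer-20169 --as helper`; Theses-free (the registered stub signature
`∀ W p, P2.RoadFF.FittingCongruenceFrameAtErratumDataB W p Σ(·) P_Σ(·)` of
`Cruxes/IMCDivAtErratumDataAllR/Lines/birth.lean` (skeleton 83006994852f) is concluded VERBATIM, from named facts only).

## What this file proves and why it exists

Twin of `Theorems/ErratumRoadFiveIMCDivRoadFFFittingFrameBOfFacts.lean` (imc-p1 g10, p517689: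
`P2.RoadFF.fittingCongruenceFrameAtErratumDataB_of_facts (hMem : O14) (hSh) (hFG)`), with the ONE OPEN input
RE-TARGETED from O14 = `Castella2018.erratum_members_exists_isTorsion_charIdeal_le_congruence_OPEN` to its
TORSION-FREE PREMISE form `Castella2018.erratum_members_exists_charIdeal_le_of_isTorsion_congruence_OPEN`
(`Literature/…/Castella2018/ErratumHidaMembersCongruenceTorsionFree.lean`, this seat; O14 ⟹ it, `….of_OPEN`).
WHY (bsd-cited-r17 D-AUDIT ADDENDUM-7 §R-f, cell INBOX 2026-08-27T07:34:51Z; director ROUTING 07:51:22Z): O14's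
members' TORSION conjunct (erratum Thm. 2.3, Heegner side, at weight `k_m ≥ p + 1`) carries ARM-P GAP-β print
provenance and is NOT used by the Road-FF consumer — p517689 binds it to a dead `have hT` and feeds the feeder's
premise-form binder `hCh : ∀ m, 1 ≤ m → Module.IsTorsion (R' m) (Nm m) → Ch(N_m)·S'_m ⊆ (L_m)` ignoring the premise.
Here the SAME assembly runs from the weaker fact: `hCh := fun m _ hT ↦ (2.5)_m hT`. Consequence for the crux: its
by-name OPEN stub can be re-registered on the weaker `Prop` (skeleton v4-B‴), after which the deciding crux's OPEN
input carries GAP-α/α′ (erratum (2.4) ⟸ [FW21, Thm. 4.41], preprint) + PUB chains ONLY.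

* **`P2.RoadFF.fittingCongruenceFrameAtErratumDataB_of_weak_facts`** — THE DECIDING STUB from THREE named facts:
  (OPEN, claim-tagged, UNREFEREED) `Castella2018.erratum_members_exists_charIdeal_le_of_isTorsion_congruence_OPEN`
  (frame of `f` [Cas18 3.1] + Hida members with (b), (2.5)_m via [FW21 4.41] UNDER the torsion premise, (c));
  (PUB) `SkinnerUrban2014.prop323_XAc_equiv_XBigDecomp` (Shapiro, [SU14] Prop. 3.2.3) and
  `SkinnerUrban2014.lemma319_finite_XBig` ([SU14] Lemma 3.1.9, `ℤ_p` form). Every other input is a THEOREM of the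
  tree, exactly as in p517689: (SelBC) `Skinner2016.selmerBig_extendScalars_equiv_baseChange_holds` (p512382), the
  `Σ`-bridge `Castella2018.selmerBig_eq_selmerBigDecomp_of_unramifiedOutside_holds` (p515125), finite generation of
  `X^Σ_ac(A_{g_m})` over `Λ_{𝒪_m}` (`SkinnerUrban2014.moduleFinite_XBig_of_lemma319` p513272 with p515080, p515972),
  (Frob) ∕ PID ∕ finite free (T1 p503222), faithful flatness (T4 p507140), the member congruence
  `RoadFFMember.nonempty_memberCongruence_erratum_of_facts` (p516079), the feeder
  `P2.RoadFF.fittingCongruenceFrameTwoSlotAt_of_members_descent_le_printed` (p495387) with `R'_m = 𝒪_m⟦T⟧`,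
  `N_m = XBig κ (A_{g_m}|_{Γ_K}) 𝔭bar Σ`, `S'_m = (R₀ ⊗_{ℤ_p} 𝒪_m)⟦T⟧`, `φ'_m = map includeRight`, `L^Σ = L·P_Σ`,
  `Σ = W.sigmaPlacesFinset p K`; flag Mem-M-ge-3 (`3 ≤ N/p`) discharged as there (`q` odd, `q ∣ N/p`).
* That the re-target loses nothing is the Literature projection `….of_OPEN` (O14 ⟹ weak form): p517689's
  `…_of_facts hMem` is `…_of_weak_facts (….of_OPEN hMem)` up to proof irrelevance (not restated here — dedup).

HONEST FRAMING: theorems only (no definition, no named fact minted here, no instance, no `sorry`); CONDITIONAL on the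
three named facts, one of which (the member package, resting on the unrefereed erratum and arXiv:2107.13726 Thm. 4.41)
is OPEN; nothing is booked; the anticyclotomic main conjecture is asserted nowhere; BSD is proved for no pair; no
census number moves (T7).

References: [Castella2018Erratum] Thm. 1.1, §2, Thm. 2.3, (2.3)–(2.5), (b), (c), Lemma 2.1, proof of Thm. 1.1
(pp. 1–4); [FouquetWan2021] Thm. 4.41 (PREPRINT); [Skinner2016PacificMC] §2.3 (p. 179), §2.6 (2-6-1), §3.1 (p. 191);
[SkinnerUrban2014] Prop. 3.2.3, Lemma 3.1.9 (p. 20); [Castella2020JIMJ] §2.5, Thm. 2.11; [Castella2018] Def. 2.2,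
Thm. 3.1, (3.1) (arXiv:1704.06608 pp. 5, 9); pub/bsd-cited/sheets/AUDIT-Castella2018-ErratumHidaMembers-T3-r17-ADDENDUM-7-f97a85fb.md §R-f;
HOME/imc-p1/g10/STUB2-CLOSED-MODULO-FACTS-20169-imc-p1-g10.md.
-/

set_option autoImplicit false

noncomputable section

open scoped TensorProduct Classical

open CategoryTheory PowerSeries NumberField IsDedekindDomain Field WeierstrassCurve
open Literature.NumberTheory.GaloisRepresentations Literature.NumberTheory.EllipticCurves
  Literature.NumberTheory.EllipticCurves.BigGaloisRep Literature.NumberTheory.EllipticCurves.GreenbergSelmer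
  Literature.NumberTheory.EllipticCurves.Skinner2016 Literature.NumberTheory.EllipticCurves.Rank1Residual
  Literature.NumberTheory.EllipticCurves.Rank1Residual.Typed Literature.NumberTheory.EllipticCurves.ModularForms
  Literature.NumberTheory.EllipticCurves.Castella2018
open Summit.BirchSwinnertonDyer.Rank1Residual.X11b.Halves Summit.BirchSwinnertonDyer.Rank1Residual.X11b.AcSelmer

/-! ### The deciding stub of skeleton v4-B″ from the named facts, OPEN input in torsion-free premise form -/

namespace Summit.BirchSwinnertonDyer.Rank1Residual.X11b

open RoadFFMember Summit.BirchSwinnertonDyer.BirchSwinnertonDyer.Theorems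

-- The closing `exact` unifies five `ℕ`-indexed families of coefficient rings / modules / maps with the feeder's
-- binders; it needs ≈ 2× the default heartbeat budget (measured: fails at 200 000, passes at 400 000).
set_option maxHeartbeats 400000 in
/-- **ROAD FF, DECIDING STUB `stub_roadFF_fittingCongruenceFrameB` OF CRUX `IMCDivAtErratumDataAllR` (item
stmt-BirchSwinnertonDyer-20169), MODULO NAMED FACTS — OPEN INPUT IN TORSION-FREE PREMISE FORM (R-f).** For every globally minimal elliptic `W/ℚ` and prime `p`, at
every erratum datum and every X-slot `𝔭bar ≠ 𝔭_{ι'}`: the two-slot Fitting-level congruence frame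
`P2.RoadFF.FittingCongruenceFrameTwoSlotAt W p κ 𝔭_{ι'} 𝔭bar γ ι' f_E Σ(K) P_Σ(K, κ)` — i.e. EXACTLY the registered
signature `∀ W p, P2.RoadFF.FittingCongruenceFrameAtErratumDataB W p Σ(·) P_Σ(·)` — from
* (OPEN, claim-tagged; UNREFEREED) the erratum's member package in torsion-free premise form
  `Castella2018.erratum_members_exists_charIdeal_le_of_isTorsion_congruence_OPEN` (frame of `f` at `(ι', 𝔭_{ι'})`
  [Cas18 Thm. 3.1], Hida members `g_m` with (b), (2.5)_m via [FW21, Thm. 4.41] UNDER the premise "`X^Σ_ac(A_{g_m})`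
  torsion", (c) [Cas20 2.11]) — WITHOUT erratum Thm. 2.3's torsion clause (GAP-β provenance), which is not used;
* (PUB) `SkinnerUrban2014.prop323_XAc_equiv_XBigDecomp` (Shapiro) and `SkinnerUrban2014.lemma319_finite_XBig`
  (finite generation of dual Selmer groups, [SU14] Lemma 3.1.9);
every other input being a THEOREM of the tree ((SelBC) `…_holds` p512382, the `Σ`-bridge `…_holds` p515125,
`moduleFinite_XBig_of_lemma319` p513272, (T1), (T4), (T7), (T8a)).
Assembly: the binders of the member package are discharged from the erratum datum (`5 ≤ p`; `Mult W p`; `Irr`; the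
Heegner datum's `β`; `p` split and every `ℓ ∣ N`, `ℓ ≠ q` split on an erratum field; `q ∣ d_K` nonsplit; (ii) from the
field's `2`-clause; (iv) from the A′-locus; `3 ≤ N/p` since `q` is ODD (`d_K` odd by `Cas20Standing`, `q ∣ d_K`) and
`pq ∣ N`); per `m ≥ 1` the member `D_m` (level `max m 1`), its coefficient ring `𝒪_m` (PID, finite free over `ℤ_p`:
defn-ty1 (T1)), the receptacle `S'_m = (R₀ ⊗_{ℤ_p} 𝒪_m)⟦T⟧` (faithfully flat over `R₀⟦T⟧`: (T4)), the congruence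
`e_m` (`nonempty_memberCongruence_erratum_tame`: (F1) + (SelBC) + (Frob) + (b) + Lemma 2.1), `N_m` torsion →
`Ch·S' ⊆ (L_m)` (premise form, passed to the feeder's `hCh` AS IS) and `(L_m) ⊆ (L·P_Σ) + (p^m)` read in `S'_m`
(`a = algebraMap`, `b = includeRight`, `j = toUnr`), fed to
`P2.RoadFF.fittingCongruenceFrameTwoSlotAt_of_members_descent_le_printed` (p495387). CONDITIONAL on the three named
facts (one of them OPEN and unrefereed); nothing is booked; BSD is proved for no pair; no census number moves (T7).
[claim: Castella2018Erratum, status: under-review] [claim: FouquetWan2021, status: under-review]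
[cite: Castella2018Erratum, Thm. 1.1, Thm. 2.3, (2.3)–(2.5), (b), (c), Lemma 2.1 and proof of Thm. 1.1 (pp. 1–4)]
[cite: Skinner2016PacificMC, §2.3 (p. 179), §2.6 (2-6-1), §3.1 (a)(b) (p. 192)] [cite: SkinnerUrban2014, Prop. 3.2.3, Lemma 3.1.9]
[cite: Castella2020JIMJ, §2.5, Thm. 2.11] [cite: Castella2018, Thm. 3.1, (3.1) (arXiv:1704.06608 p. 9)] -/
theorem P2.RoadFF.fittingCongruenceFrameAtErratumDataB_of_weak_facts
    (hMem : erratum_members_exists_charIdeal_le_of_isTorsion_congruence_OPEN)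
    (hSh : SkinnerUrban2014.prop323_XAc_equiv_XBigDecomp) (hFG : SkinnerUrban2014.lemma319_finite_XBig)
    (W : WeierstrassCurve ℚ) [W.IsElliptic] [W.IsGloballyMinimal] (p : ℕ) [Fact p.Prime] :
    P2.RoadFF.FittingCongruenceFrameAtErratumDataB W p
      (fun K _ _ ↦ (↑(W.sigmaPlacesFinset p K) : Set (HeightOneSpectrum (𝓞 K))))
      (fun K _ _ κ _ ↦ W.sigmaEulerElement p K κ) := by
  intro _ q _ K _ _ Dt H w₀ P hE hr hqp hmq hns hvq hK hCas hP hc hinf κ hκ γ _ ι' e he 𝔭bar h𝔭bar hne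
  show P2.RoadFF.FittingCongruenceFrameTwoSlotAt W p κ (primeOfEmbeddingDatum p ι' w₀.embedding) 𝔭bar γ ι'
    Dt.f (↑(W.sigmaPlacesFinset p K) : Set (HeightOneSpectrum (𝓞 K))) (W.sigmaEulerElement p K κ)
  -- ### the datum's elementary consequences
  have hp5 : 5 ≤ p := hE.1
  have hp3 : 3 < p := lt_of_lt_of_le (by norm_num) hp5
  have hmult : Mult W p := hE.2.1
  have hirr : Irr W p := hE.2.2.1
  have htors : ∀ Q : (W.baseChange ℚ_[p]).toAffine.Point, p • Q = 0 → Q = 0 := hE.2.2.2.2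
  have hpN : p ∣ W.conductorNorm ℤ := dvd_conductorNorm_of_mult hmult
  have hsplit2 : ((Ideal.span {(p : ℤ)}).primesOver (𝓞 K)).ncard = 2 :=
    hK.ncard_primesOver_eq_two Fact.out hpN hqp
  have hsp : SplitsIn K p := hK.splitsIn_of_mult hmult (Ne.symm hqp)
  have hHp : SatisfiesHeegnerHypothesis p K := satisfiesHeegnerHypothesis_of_splitsIn Fact.out hsp
  have hHeeg : ∃ β : ℤ, (4 * (W.conductorNorm ℤ) : ℤ) ∣ β ^ 2 - NumberField.discr K :=
    ⟨H.β, H.dvd_sq_sub⟩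
  have hnq : ((Ideal.span {(q : ℤ)}).primesOver (𝓞 K)).ncard ≠ 2 :=
    ncard_primesOver_ne_two_of_dvd_discr hK.1.1 Fact.out hK.2.1
  -- every multiplicative prime nonsplit in `K` is `q`
  have key : ∀ (ℓ : ℕ) [Fact ℓ.Prime], Mult W ℓ →
      ((Ideal.span {(ℓ : ℤ)}).primesOver (𝓞 K)).ncard ≠ 2 → ℓ = q := by
    intro ℓ _ hℓ hnsℓ
    by_contra hne'
    exact hnsℓ (hK.2.2.1 ℓ Fact.out (dvd_conductorNorm_of_mult hℓ) hne')
  -- (ii) if `2` is nonsplit then `2 ∥ N`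
  have h2 : ((Ideal.span {(2 : ℤ)}).primesOver (𝓞 K)).ncard ≠ 2 → Mult W 2 := by
    intro h2ns
    by_cases h2N : 2 ∣ W.conductorNorm ℤ
    · by_cases h2q : (2 : ℕ) = q
      · haveI : Fact (Nat.Prime 2) := ⟨Nat.prime_two⟩
        subst h2q
        exact hmq
      · exact absurd (hK.2.2.1 2 Nat.prime_two h2N h2q) h2ns
    · exact absurd (hK.2.2.2.1 h2N) h2ns
  -- (iii) nonsplit multiplicative at the nonsplit multiplicative primes (= `q`), `E[p]` ramified at `q`
  have hns' : ∀ (ℓ : ℕ) [Fact ℓ.Prime], Mult W ℓ →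
      ((Ideal.span {(ℓ : ℤ)}).primesOver (𝓞 K)).ncard ≠ 2 →
        ¬ W.HasSplitMultiplicativeReductionAtPrime ℓ := by
    intro ℓ _ hℓ hnsℓ
    obtain rfl := key ℓ hℓ hnsℓ
    exact hns
  have hram' : ∃ (ℓ : ℕ) (_ : Fact ℓ.Prime), Mult W ℓ ∧
      ((Ideal.span {(ℓ : ℤ)}).primesOver (𝓞 K)).ncard ≠ 2 ∧
        ¬ p ∣ padicValInt ℓ W.minimalDiscriminantInt :=
    ⟨q, ‹_›, hmq, hnq, hvq⟩
  -- `3 ≤ M = N/p` (Thm. 2.3's level hypothesis): `q` is odd (`d_K` odd, `q ∣ d_K`) and `q ∣ N/p`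
  have hMpos : 0 < W.conductorNorm ℤ / p := hCas.2.2.2.2.2.1
  have hpM : ¬ p ∣ W.conductorNorm ℤ / p := hCas.2.2.2.2.2.2.1
  have hq2 : q ≠ 2 := by
    rintro rfl
    have hodd : Odd (NumberField.discr K) := hCas.2.1
    have h2d : (2 : ℤ) ∣ NumberField.discr K := by exact_mod_cast hK.2.1
    exact (Int.not_even_iff_odd.mpr hodd) (even_iff_two_dvd.mpr h2d)
  have hM : 3 ≤ W.conductorNorm ℤ / p := by
    have hqprime : q.Prime := Fact.out
    have hqN : q ∣ W.conductorNorm ℤ := dvd_conductorNorm_of_mult hmq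
    have hqM : q ∣ W.conductorNorm ℤ / p := by
      rw [← Nat.div_mul_cancel hpN] at hqN
      exact ((Nat.Coprime.dvd_mul_right ((Nat.coprime_primes hqprime Fact.out).2 hqp)).1 hqN)
    have hq3 : 3 ≤ q := by
      rcases hqprime.eq_two_or_odd' with h | h
      · exact absurd h hq2
      · have := hqprime.two_le; omega
    exact hq3.trans (Nat.le_of_dvd hMpos hqM)
  haveI : NeZero (W.conductorNorm ℤ / p) := ⟨hMpos.ne'⟩
  -- ### `Σ`
  have hSfin : (↑(W.sigmaPlacesFinset p K) : Set (HeightOneSpectrum (𝓞 K))).Finite :=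
    (W.sigmaPlacesFinset p K).finite_toSet
  have hSp : ∀ w ∈ (↑(W.sigmaPlacesFinset p K) : Set (HeightOneSpectrum (𝓞 K))),
      ((p : ℕ) : 𝓞 K) ∉ w.asIdeal :=
    fun w hw => W.forall_mem_sigmaPlacesFinset_not_mem p K w (Finset.mem_coe.1 hw)
  have hS : ∀ w : HeightOneSpectrum (𝓞 K), w ∉ (↑(W.sigmaPlacesFinset p K) : Set (HeightOneSpectrum (𝓞 K))) →
      ((p : ℕ) : 𝓞 K) ∉ w.asIdeal → (W.baseChange K).HasGoodReductionAt w := by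
    intro w hw hwp
    rw [WeierstrassCurve.coe_sigmaPlacesFinset] at hw
    exact WeierstrassCurve.hasGoodReductionAt_baseChange_of_not_mem_sigmaPlaces hw hwp
  have hSM : ∀ w : HeightOneSpectrum (𝓞 K), w ∉ (↑(W.sigmaPlacesFinset p K) : Set (HeightOneSpectrum (𝓞 K))) →
      ((W.conductorNorm ℤ / p : ℕ) : 𝓞 K) ∉ w.asIdeal := by
    intro w hw hM'
    rw [WeierstrassCurve.coe_sigmaPlacesFinset] at hw
    exact hw (WeierstrassCurve.mem_sigmaPlaces_of_tameLevel_mem hpN hpM hM')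
  -- ### `K_{𝔭bar} → ℚ_p` (degree one)
  obtain ⟨heb, hfb⟩ := degreeOne_of_splitsIn hK.1.1 hsp h𝔭bar
  obtain ⟨φ⟩ := AcSelmer.exists_ringHom_adicCompletion_padic_of_degreeOne p 𝔭bar h𝔭bar heb hfb
  -- ### the member package (torsion-free premise form of T3)
  obtain ⟨ΩK, Ωp, L, hΩ, hL, hmem⟩ :=
    exists_frame_members_charIdeal_le_of_isTorsion_congruence_le_of_OPEN ι' W K
      (primeOfEmbeddingDatum p ι' w₀.embedding)
      𝔭bar κ γ Dt.isNewformOf rfl hp3 hmult hM hK.1 hHeeg hsplit2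
      (natCast_mem_primeOfEmbeddingDatum p ι' w₀.embedding) (forall_mem_primeOfEmbeddingDatum_iff p ι' hK.1 w₀)
      h𝔭bar hne hirr h2 hns' hram' htors hκ hMem
  -- a member at every level `max m 1`
  choose Dm hDm using fun m : ℕ => hmem (max m 1) (le_max_right m 1)
  -- ### topologies (the statements are topology-free; take discrete ones) and coefficient-ring instances
  letI : TopologicalSpace (IwasawaAlgebra p) := ⊥
  haveI : DiscreteTopology (IwasawaAlgebra p) := ⟨rfl⟩
  letI τ : ∀ m : ℕ, TopologicalSpace (PowerSeries (padicCoeffIntegers (Dm m).ι)) := fun _ => ⊥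
  haveI : ∀ m : ℕ, DiscreteTopology (PowerSeries (padicCoeffIntegers (Dm m).ι)) := fun _ => ⟨rfl⟩
  haveI : ∀ m : ℕ, IsPrincipalIdealRing (padicCoeffIntegers (Dm m).ι) := fun m =>
    (Dm m).isPrincipalIdealRing_coeffRing
  haveI : ∀ m : ℕ, Module.Free ℤ_[p] (padicCoeffIntegers (Dm m).ι) := fun m => (Dm m).moduleFree_coeffRing
  haveI : ∀ m : ℕ, Module.Finite ℤ_[p] (padicCoeffIntegers (Dm m).ι) := fun m =>
    (Dm m).moduleFinite_coeffRing
  letI : Algebra ℤ_[p] (unrIntegers p) := (toUnr p).toAlgebra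
  have hj : algebraMap ℤ_[p] (unrIntegers p) = toUnr p := rfl
  haveI : ∀ m : ℕ, Module.FaithfullyFlat (UnrSeries p)
      (PowerSeries (unrIntegers p ⊗[ℤ_[p]] padicCoeffIntegers (Dm m).ι)) := fun m =>
    faithfullyFlat_receptacle p (padicCoeffIntegers (Dm m).ι)
  -- the receptacle clause of every member: (2.5)_m under the torsion premise, and (c)
  have hrec : ∀ m : ℕ, ∃ Lm : PowerSeries (unrIntegers p ⊗[ℤ_[p]] padicCoeffIntegers (Dm m).ι),
      (Module.IsTorsion (PowerSeries (padicCoeffIntegers (Dm m).ι))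
          (XBig κ ((Dm m).Δ.cofreeRepOver K) 𝔭bar (↑(W.sigmaPlacesFinset p K) : Set (HeightOneSpectrum (𝓞 K)))) →
        (XBig.charIdeal κ ((Dm m).Δ.cofreeRepOver K) 𝔭bar
            (↑(W.sigmaPlacesFinset p K) : Set (HeightOneSpectrum (𝓞 K)))).map
            (PowerSeries.map (Algebra.TensorProduct.includeRight (R := ℤ_[p]) (A := unrIntegers p)
              (B := padicCoeffIntegers (Dm m).ι)).toRingHom) ≤ Ideal.span {Lm}) ∧
        Ideal.span {Lm} ≤
          Ideal.span {PowerSeries.map (algebraMap (unrIntegers p)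
              (unrIntegers p ⊗[ℤ_[p]] padicCoeffIntegers (Dm m).ι))
              (L * PowerSeries.map (toUnr p) (W.sigmaEulerElement p K κ))} ⊔
            Ideal.span {((p : ℕ) : PowerSeries (unrIntegers p ⊗[ℤ_[p]] padicCoeffIntegers (Dm m).ι)) ^
              (max m 1)} :=
    fun m => hDm m _ (algebraMap _ _) _ (toUnr p) (coe_toUnr p)
      (algebraMap_comp_toUnr_eq p (padicCoeffIntegers (Dm m).ι) hj)
  choose Lm hLm using hrec
  -- finite generation of `X^Σ_ac(A_{g_m})` over `Λ_{𝒪_m}`: SU14 Lemma 3.1.9 (the `ℤ_p` fact `hFG`) through defn-ty1's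
  -- coefficient reduction (T6) with (T7) `A_g` `p`-primary with finite `p`-torsion and (T8a) unramified outside `Σ ∪ S_p`
  haveI : ∀ m : ℕ, Module.Finite (PowerSeries (padicCoeffIntegers (Dm m).ι))
      (XBig κ ((Dm m).Δ.cofreeRepOver K) 𝔭bar (↑(W.sigmaPlacesFinset p K) : Set (HeightOneSpectrum (𝓞 K)))) :=
    fun m =>
      haveI := (Dm m).finiteDimensional_padicCoeffField
      SkinnerUrban2014.moduleFinite_XBig_of_lemma319 hFG κ 𝔭bar _ hSfin ((Dm m).Δ.cofreeRepOver K)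
        (GreenbergSelmer.Cofree.exists_pow_psmul_eq_zero (Dm m).ι (Dm m).Δ.ρ)
        (GreenbergSelmer.Cofree.divisible (padicCoeffField (Dm m).ι) (Dm m).Δ.ρ (Fact.out : p.Prime).ne_zero)
        (GreenbergSelmer.Cofree.finite_setOf_psmul_eq_zero (Dm m).ι (Dm m).Δ.ρ)
        (GreenbergSelmer.OrdinaryNewformDatum.cofreeRepOver_localMap_inr_apply_eq_self (Dm m).Δ K _ hSM)
  -- ### the member congruences `e_m`: (F1) + (SelBC) + (Frob) + (b) + Lemma 2.1, at the member of level `max m 1 = m`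
  have hEm : ∀ m : ℕ, 1 ≤ m →
      Nonempty ((((PowerSeries (padicCoeffIntegers (Dm m).ι)) ⊗[IwasawaAlgebra p]
            AcSelmer.XAc (W.baseChange K) p κ 𝔭bar (↑(W.sigmaPlacesFinset p K) : Set (HeightOneSpectrum (𝓞 K))) γ) ⧸
          (((Ideal.span {(C (p : ℤ_[p]) : IwasawaAlgebra p)}).map
              (algebraMap (IwasawaAlgebra p) (PowerSeries (padicCoeffIntegers (Dm m).ι)))) ^ m •
            (⊤ : Submodule (PowerSeries (padicCoeffIntegers (Dm m).ι))
              ((PowerSeries (padicCoeffIntegers (Dm m).ι)) ⊗[IwasawaAlgebra p]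
                AcSelmer.XAc (W.baseChange K) p κ 𝔭bar (↑(W.sigmaPlacesFinset p K) : Set (HeightOneSpectrum (𝓞 K))) γ))))
          ≃ₗ[PowerSeries (padicCoeffIntegers (Dm m).ι)]
        (XBig κ ((Dm m).Δ.cofreeRepOver K) 𝔭bar (↑(W.sigmaPlacesFinset p K) : Set (HeightOneSpectrum (𝓞 K))) ⧸
          (((Ideal.span {(C (p : ℤ_[p]) : IwasawaAlgebra p)}).map
              (algebraMap (IwasawaAlgebra p) (PowerSeries (padicCoeffIntegers (Dm m).ι)))) ^ m •
            (⊤ : Submodule (PowerSeries (padicCoeffIntegers (Dm m).ι))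
              (XBig κ ((Dm m).Δ.cofreeRepOver K) 𝔭bar (↑(W.sigmaPlacesFinset p K) : Set (HeightOneSpectrum (𝓞 K)))))))) := by
    intro m hm
    exact nonempty_quotPow_congr_of_eq _ (max_eq_left hm)
      (nonempty_memberCongruence_erratum_of_facts hSh selmerBig_eq_selmerBigDecomp_of_unramifiedOutside_holds
        Skinner2016.selmerBig_extendScalars_equiv_baseChange_holds hp5 hirr hK.1 hHp 𝔭bar h𝔭bar φ htors _ hSfin
        hSp hS hSM κ hκ γ (Dm m) (le_max_right m 1)).some
  -- ### (c), one-sided, with `(p^m)` in the consumer's spelling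
  have hc' : ∀ m : ℕ, 1 ≤ m →
      Ideal.span {Lm m} ≤
        Ideal.span {algebraMap (UnrSeries p) (PowerSeries (unrIntegers p ⊗[ℤ_[p]] padicCoeffIntegers (Dm m).ι))
            (L * PowerSeries.map (toUnr p) (W.sigmaEulerElement p K κ))} ⊔
          (((Ideal.span {(C (p : ℤ_[p]) : IwasawaAlgebra p)}).map (PowerSeries.map (toUnr p))).map
            (algebraMap (UnrSeries p) (PowerSeries (unrIntegers p ⊗[ℤ_[p]] padicCoeffIntegers (Dm m).ι)))) ^ m :=
    fun m hm => span_le_sup_of_receptacle p (padicCoeffIntegers (Dm m).ι) hm _ (Lm m) (hLm m).2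
  -- ### feed the two-slot Fitting congruence frame
  exact P2.RoadFF.fittingCongruenceFrameTwoSlotAt_of_members_descent_le_printed hΩ hL
    (L * PowerSeries.map (toUnr p) (W.sigmaEulerElement p K κ)) (dvd_refl _) hSfin
    (fun m => PowerSeries (padicCoeffIntegers (Dm m).ι))
    (fun m => PowerSeries (unrIntegers p ⊗[ℤ_[p]] padicCoeffIntegers (Dm m).ι))
    (fun m => PowerSeries.map (Algebra.TensorProduct.includeRight (R := ℤ_[p]) (A := unrIntegers p)
      (B := padicCoeffIntegers (Dm m).ι)).toRingHom)
    (fun m => map_includeRight_comp_algebraMap p (padicCoeffIntegers (Dm m).ι) hj)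
    (fun m => XBig κ ((Dm m).Δ.cofreeRepOver K) 𝔭bar (↑(W.sigmaPlacesFinset p K) : Set (HeightOneSpectrum (𝓞 K))))
    Lm (fun m hm => (hEm m hm).some) (fun m _ hTm => (hLm m).1 hTm) hc'

end Summit.BirchSwinnertonDyer.Rank1Residual.X11b

end
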